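import Mathlib.Analysis.SpecialFunctions.Trigonometric.Inverse
import Mathlib.Analysis.SpecialFunctions.Sqrt
import Literature.MathematicalPhysics.QuantumLattice.HubbardFermiCurve
import HarnessLib

/-!
# Transverse umklapp quartets on the square-lattice Fermi curve (Proposition U)

Soloist `solo-HubbardSuperconductivity-informed`, sharpest-statement memo §2d, Proposition U — the
geometric fact under the first missing input of "door (b)" (finite-temperature Fermi-liquid
constructions) for the summit's own band on the summit's own density window.

**Statement.** In the tree's convention `ε(k) = -2(cos k₁ + cos k₂)` (`sqDispersion`, band `[-4, 4]`),
for EVERY chemical potential in the hole-doped window `-2 < μ < 0` (densities `0.37 < n < 1`; this is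
`1 < μ_BGM < 2` in the convention `ε = 2 - cos k₁ - cos k₂` of Benfatto–Giuliani–Mastropietro) there
are Fermi momenta `P = (a, b)` and `K = (2π - 3a, -3b)`, both on the Fermi curve `{ε = μ}` and both in
the Brillouin zone `(-π, π]²`, with

* `K + 3P = (2π, 0)` — a genuine UMKLAPP quartet `(K; P, P, P)`: momentum is conserved modulo the
  reciprocal lattice `2πℤ²` but not in `ℝ²` (`exists_transverse_umklapp_quartet`);
* TRANSVERSE Fermi velocities: `v(P) ∧ v(K) < 0`, in particular non-parallel, where
  `v(k) = ∇ε(k) = (2 sin k₁, 2 sin k₂)` (written out in components; that these are the partial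
  derivatives of `sqDispersion` is `hasDerivAt_sqDispersion_fst/snd`);
* the exact angle formula `v(P) · v(K) = (μ² - 1)(16 - μ²)/9`: obtuse for `-2 < μ < -1`,
  PERPENDICULAR at `μ = -1` (`exists_orthogonal_umklapp_quartet`; there `P = (3π/5, -π/5)`-type points,
  `cos a = (1 - √5)/4`, `cos b = (1 + √5)/4`), acute for `-1 < μ < 0`.

The witnesses are algebraic: with `c = -μ/2 ∈ (0, 1)` and `s = √(12 - 3c²)`, `cos a = c/2 - s/6`,
`cos b = c/2 + s/6` (`exists_caustic_cosines`), so that `cos a + cos b = c`, `cos a · cos b = (c² - 1)/3`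
and hence `cos 3a + cos 3b = 4(cos³a + cos³b) - 3(cos a + cos b) = c`; the trigonometry given the two
cosines is `umklapp_quartet_of_cosines`. No new definitions are introduced. At `μ = -2`
the quartet degenerates (`K = P = (π/2, 0)`, `4P ∈ 2πℤ²`): the window is exactly where four-leg umklapp
is on shell, cf. `HubbardFermiCurve.lean` (BGM 2006's range `-4 < μ < -2 - √2` is where NO umklapp with
`≤ 8` legs is on shell).

**Why it matters (memo §2d; not formalised here).** Every printed sector-counting lemma for a
strictly convex curved Fermi curve — BGM 2003 Lemma 3.1 / App. A1, BGM 2006 Lemma A3.1 and (A2.0),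
Mastropietro 2008 (14.65), Wang 2023 Lemma 2.1 — imposes momentum conservation IN `ℝ²`; the anchored
anisotropic lemma's key step (BGM 2003 App. A1, (s1.34): `Σ k⁽ⁱ⁾ = 0` forces the anchor to be collinear
with a collinear cluster) fails for `Σ k⁽ⁱ⁾ ∈ 2πℤ² ∖ 0` precisely at the quartets exhibited here, where
the anchor `K` is transverse to the cluster `P, P, P`; the memo's model computation measures the loss
(one full factor `γ^{(h-h')/2}` in the anchored count; the `ℓ¹` count and the isotropic single-scale
count survive). So BGM 2003's counterterm theorem is proved only where BGM 2006's no-umklapp hypothesis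
holds, and an umklapp-tolerant sector count on this window is not in print. This file records only the
exact geometric proposition; it is new (elementary) mathematics, hence Summits-side.

## Sources

* G. Benfatto, A. Giuliani, V. Mastropietro, Ann. Henri Poincaré 4 (2003) 137–193
  (arXiv:cond-mat/0207210), Lemma 3.1 and App. A1 (s1.31)–(s1.42). [BenfattoGiulianiMastropietro2003]
* G. Benfatto, A. Giuliani, V. Mastropietro, Ann. Henri Poincaré 7 (2006) 809–898
  (arXiv:cond-mat/0507686), Thm. 1.1, (2.39) and the remark after (2.76) ("umklapp processes are
  impossible if `|P_v| ≤ 8` because of the condition on `μ`"). [BenfattoGiulianiMastropietro2006]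
-/

noncomputable section

open Real Set

namespace Summit.HubbardSuperconductivity.HubbardSuperconductivity.Theorems

open Literature.MathematicalPhysics.QuantumLattice

/-! ### The dispersion on explicit vectors and its partial derivatives (the Fermi velocity) -/

/-- `ε(x, y) = -2(cos x + cos y)` on an explicit vector. -/
theorem sqDispersion_vec (x y : ℝ) : sqDispersion ![x, y] = -2 * (Real.cos x + Real.cos y) := by
  simp [sqDispersion]

/-- `∂ε/∂k₁ (x, y) = 2 sin x`: the first component of the Fermi velocity `v = ∇ε`. -/
theorem hasDerivAt_sqDispersion_fst (x y : ℝ) :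
    HasDerivAt (fun t => sqDispersion ![t, y]) (2 * Real.sin x) x := by
  have h : (fun t => sqDispersion ![t, y]) = fun t => -2 * (Real.cos t + Real.cos y) := by
    funext t; exact sqDispersion_vec t y
  rw [h]
  have := ((Real.hasDerivAt_cos x).add_const (Real.cos y)).const_mul (-2)
  simpa using this

/-- `∂ε/∂k₂ (x, y) = 2 sin y`: the second component of the Fermi velocity. -/
theorem hasDerivAt_sqDispersion_snd (x y : ℝ) :
    HasDerivAt (fun t => sqDispersion ![x, t]) (2 * Real.sin y) y := by
  have h : (fun t => sqDispersion ![x, t]) = fun t => -2 * (Real.cos x + Real.cos t) := by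
    funext t; exact sqDispersion_vec x t
  rw [h]
  have := ((Real.hasDerivAt_cos y).const_add (Real.cos x)).const_mul (-2)
  simpa using this

/-! ### The algebraic witnesses -/

/-- For `0 < c < 1` the system `u + v = c`, `uv = (c² - 1)/3` has a real solution with
`-1 < u < 0 < 1/2 < v < 1`, namely `u, v = c/2 ∓ √(12 - 3c²)/6`. -/
theorem exists_caustic_cosines {c : ℝ} (hc0 : 0 < c) (hc1 : c < 1) :
    ∃ u v : ℝ, u + v = c ∧ u * v = (c ^ 2 - 1) / 3 ∧ (-1 < u ∧ u < 0) ∧ (1 / 2 < v ∧ v < 1) := by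
  set s := Real.sqrt (12 - 3 * c ^ 2) with hs_def
  have hs0 : 0 ≤ s := Real.sqrt_nonneg _
  have hs2 : s ^ 2 = 12 - 3 * c ^ 2 := by
    rw [hs_def, Real.sq_sqrt]; nlinarith
  have h3 : 3 < s := by nlinarith
  have h6 : s < 6 - 3 * c := by
    by_contra h
    push Not at h
    have h' : (6 - 3 * c) * (6 - 3 * c) ≤ s * s := mul_le_mul h h (by linarith) hs0
    nlinarith
  refine ⟨c / 2 - s / 6, c / 2 + s / 6, by ring, ?_, ⟨by linarith, by linarith⟩,
    ⟨by linarith, by linarith⟩⟩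
  have : (c / 2 - s / 6) * (c / 2 + s / 6) = c ^ 2 / 4 - s ^ 2 / 36 := by ring
  rw [this, hs2]; ring

/-- The trigonometry of the quartet, given the two cosines: if `cos a = u`, `cos b = v` with
`u + v = c`, `uv = (c² - 1)/3`, then `P = (a, b)` and `K = (2π - 3a, -3b)` are both on `{ε = -2c}`,
`v(P) ∧ v(K) = -16 sin a sin b · c (v - u)` and `v(P) · v(K) = -4(4c² - 1)(c² - 4)/9`. -/
theorem umklapp_quartet_of_cosines {c u v a b : ℝ} (hsum : u + v = c) (hprod : u * v = (c ^ 2 - 1) / 3)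
    (hca : Real.cos a = u) (hcb : Real.cos b = v) :
    sqDispersion ![a, b] = -2 * c ∧
    sqDispersion ![2 * π - 3 * a, -(3 * b)] = -2 * c ∧
    (2 * Real.sin a) * (2 * Real.sin (-(3 * b))) - (2 * Real.sin b) * (2 * Real.sin (2 * π - 3 * a))
      = -16 * (Real.sin a * Real.sin b) * (c * (v - u)) ∧
    (2 * Real.sin a) * (2 * Real.sin (2 * π - 3 * a)) + (2 * Real.sin b) * (2 * Real.sin (-(3 * b)))
      = -4 * ((4 * c ^ 2 - 1) * (c ^ 2 - 4)) / 9 := by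
  have hsa2 : Real.sin a ^ 2 = 1 - u ^ 2 := by rw [Real.sin_sq, hca]
  have hsb2 : Real.sin b ^ 2 = 1 - v ^ 2 := by rw [Real.sin_sq, hcb]
  refine ⟨?_, ?_, ?_, ?_⟩
  · rw [sqDispersion_vec, hca, hcb, hsum]
  · rw [sqDispersion_vec, Real.cos_two_pi_sub, Real.cos_neg, Real.cos_three_mul, Real.cos_three_mul,
      hca, hcb]
    have : 4 * u ^ 3 - 3 * u + (4 * v ^ 3 - 3 * v)
        = 4 * ((u + v) ^ 3 - 3 * (u * v) * (u + v)) - 3 * (u + v) := by ring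
    rw [this, hsum, hprod]; ring
  · rw [Real.sin_two_pi_sub, Real.sin_neg, Real.sin_three_mul, Real.sin_three_mul]
    set sa := Real.sin a
    set sb := Real.sin b
    have key : 2 * sa * (2 * -(3 * sb - 4 * sb ^ 3)) - 2 * sb * (2 * -(3 * sa - 4 * sa ^ 3))
        = -(16 * (sa * sb) * (sa ^ 2 - sb ^ 2)) := by ring
    rw [key, hsa2, hsb2]
    have h2 : (1 - u ^ 2) - (1 - v ^ 2) = (v - u) * (u + v) := by ring
    rw [h2, hsum]; ring
  · rw [Real.sin_two_pi_sub, Real.sin_neg, Real.sin_three_mul, Real.sin_three_mul]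
    set sa := Real.sin a
    set sb := Real.sin b
    have key : 2 * sa * (2 * -(3 * sa - 4 * sa ^ 3)) + 2 * sb * (2 * -(3 * sb - 4 * sb ^ 3))
        = -4 * (3 * sa ^ 2 - 4 * (sa ^ 2) ^ 2 + (3 * sb ^ 2 - 4 * (sb ^ 2) ^ 2)) := by ring
    rw [key, hsa2, hsb2]
    have key2 : 3 * (1 - u ^ 2) - 4 * (1 - u ^ 2) ^ 2 + (3 * (1 - v ^ 2) - 4 * (1 - v ^ 2) ^ 2)
        = 5 * ((u + v) ^ 2 - 2 * (u * v)) - 4 * (((u + v) ^ 2 - 2 * (u * v)) ^ 2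
            - 2 * (u * v) ^ 2) - 2 := by ring
    rw [key2, hsum, hprod]
    ring

/-- `K + 3P = (2π, 0)` for `P = (a, b)`, `K = (2π - 3a, -3b)`. -/
theorem causticK_add_three_smul_P (a b : ℝ) :
    ((![2 * π - 3 * a, -(3 * b)] : Fin 2 → ℝ) + (3 : ℝ) • ![a, b]) = ![2 * π, 0] := by
  ext i
  fin_cases i <;> simp

/-! ### Proposition U -/

/-- **Proposition U (transverse umklapp quartets).** For every `-2 < μ < 0` there are `a ∈ (π/2, π)`,
`b ∈ (0, π/3)` such that `P = (a, b)` and `K = (2π - 3a, -3b) ∈ (-π, π/2) × (-π, 0)` lie on the Fermi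
curve `{ε = μ}` of `ε = -2(cos k₁ + cos k₂)`, `K + 3P = (2π, 0)` (umklapp, not conservation in `ℝ²`),
the Fermi velocities `v(P) = (2 sin a, 2 sin b)`, `v(K) = (2 sin(2π - 3a), 2 sin(-3b))` have negative
cross product (transverse; never parallel), and `v(P)·v(K) = (μ² - 1)(16 - μ²)/9`. -/
theorem exists_transverse_umklapp_quartet {μ : ℝ} (h₁ : -2 < μ) (h₂ : μ < 0) :
    ∃ a b : ℝ,
      (π / 2 < a ∧ a < π) ∧ (0 < b ∧ b < π / 3) ∧
      ((-π < 2 * π - 3 * a ∧ 2 * π - 3 * a < π / 2) ∧ (-π < -(3 * b) ∧ -(3 * b) < 0)) ∧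
      sqDispersion ![a, b] = μ ∧
      sqDispersion ![2 * π - 3 * a, -(3 * b)] = μ ∧
      ((![2 * π - 3 * a, -(3 * b)] : Fin 2 → ℝ) + (3 : ℝ) • ![a, b] = ![2 * π, 0]) ∧
      (2 * Real.sin a) * (2 * Real.sin (-(3 * b)))
        - (2 * Real.sin b) * (2 * Real.sin (2 * π - 3 * a)) < 0 ∧
      (2 * Real.sin a) * (2 * Real.sin (2 * π - 3 * a))
        + (2 * Real.sin b) * (2 * Real.sin (-(3 * b))) = (μ ^ 2 - 1) * (16 - μ ^ 2) / 9 := by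
  have hc0 : 0 < -μ / 2 := by linarith
  have hc1 : -μ / 2 < 1 := by linarith
  obtain ⟨u, v, hsum, hprod, ⟨hu1, hu0⟩, ⟨hv1, hv2⟩⟩ := exists_caustic_cosines hc0 hc1
  -- the angles
  set a := Real.arccos u with ha_def
  set b := Real.arccos v with hb_def
  have hca : Real.cos a = u := Real.cos_arccos (by linarith) (by linarith)
  have hcb : Real.cos b = v := Real.cos_arccos (by linarith) (by linarith)
  have hum : u ∈ Icc (-1 : ℝ) 1 := ⟨by linarith, by linarith⟩
  have hvm : v ∈ Icc (-1 : ℝ) 1 := ⟨by linarith, by linarith⟩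
  have ha1 : π / 2 < a := by
    rw [← Real.arccos_zero, ha_def]
    exact Real.strictAntiOn_arccos hum ⟨by norm_num, by norm_num⟩ hu0
  have ha2 : a < π := by
    rw [← Real.arccos_neg_one, ha_def]
    exact Real.strictAntiOn_arccos ⟨by norm_num, by norm_num⟩ hum hu1
  have hb1 : 0 < b := Real.arccos_pos.2 hv2
  have h13 : Real.arccos (1 / 2) = π / 3 := by
    have e1 : (0 : ℝ) ≤ π / 3 := by linarith [Real.pi_pos]
    have e2 : π / 3 ≤ π := by linarith [Real.pi_pos]
    rw [← Real.cos_pi_div_three, Real.arccos_cos e1 e2]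
  have hb2 : b < π / 3 := by
    rw [← h13, hb_def]
    exact Real.strictAntiOn_arccos ⟨by norm_num, by norm_num⟩ hvm hv1
  have hsa : 0 < Real.sin a := Real.sin_pos_of_pos_of_lt_pi (by linarith [Real.pi_pos]) ha2
  have hsb : 0 < Real.sin b := Real.sin_pos_of_pos_of_lt_pi hb1 (by linarith [Real.pi_pos])
  obtain ⟨hP, hK, hcross, hdot⟩ := umklapp_quartet_of_cosines hsum hprod hca hcb
  refine ⟨a, b, ⟨ha1, ha2⟩, ⟨hb1, hb2⟩, ⟨⟨by linarith, by linarith⟩, ⟨by linarith, by linarith⟩⟩,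
    ?_, ?_, causticK_add_three_smul_P a b, ?_, ?_⟩
  · rw [hP]; ring
  · rw [hK]; ring
  · rw [hcross]
    have h4 : 0 < Real.sin a * Real.sin b := mul_pos hsa hsb
    have h5 : 0 < -μ / 2 * (v - u) := mul_pos hc0 (by linarith)
    have h6 : 0 < 16 * (Real.sin a * Real.sin b) * (-μ / 2 * (v - u)) := by positivity
    linarith
  · rw [hdot]; ring

/-- **The perpendicular quartet at `μ = -1`.** At `μ = -1` (`c = 1/2`; `μ = 3/2` in the convention
`ε = 2 - cos k₁ - cos k₂`; density `n ≈ 0.62`, hole doping `≈ 0.38`) the umklapp quartet of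
Proposition U has PERPENDICULAR Fermi velocities at the anchor `K` and the cluster point `P`. -/
theorem exists_orthogonal_umklapp_quartet :
    ∃ a b : ℝ,
      (π / 2 < a ∧ a < π) ∧ (0 < b ∧ b < π / 3) ∧
      sqDispersion ![a, b] = -1 ∧
      sqDispersion ![2 * π - 3 * a, -(3 * b)] = -1 ∧
      ((![2 * π - 3 * a, -(3 * b)] : Fin 2 → ℝ) + (3 : ℝ) • ![a, b] = ![2 * π, 0]) ∧
      (2 * Real.sin a) * (2 * Real.sin (2 * π - 3 * a))
        + (2 * Real.sin b) * (2 * Real.sin (-(3 * b))) = 0 := by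
  obtain ⟨a, b, ha, hb, -, hP, hK, hs, -, hdot⟩ :=
    exists_transverse_umklapp_quartet (μ := -1) (by norm_num) (by norm_num)
  exact ⟨a, b, ha, hb, hP, hK, hs, by rw [hdot]; norm_num⟩

end Summit.HubbardSuperconductivity.HubbardSuperconductivity.Theorems
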